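import Mathlib

/-!
# SoloBlindCayleyDuality — the Cayley involution `φ(t) = (1 - t)/(1 + t)` on level-4 iterated integrals

Solo programme `solo-KontsevichZagierPeriods-blind`, session s23 (paper/hodge.md §8.15, relation family (OCT)).

The octahedral group of homographies of `P¹` permuting `{0, ∞, 1, -1, i, -i}` has exactly one non-trivial
element mapping the integration path `[0,1]` onto itself: the half-turn `φ(t) = (1 - t)/(1 + t)`
(`0 ↔ 1`, `i ↔ -i`, `-1 ↔ ∞`, orientation of `[0,1]` reversed).  Pulling the level-4 forms
`ω_a = dt/(t - a)`, `a ∈ {0, 1, -1, i, -i}`, back along `t = φ(s)` gives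

`φ*ω_a = ω_{φ(a)} - ω_{-1}` for `a ≠ -1`,  `φ*ω_{-1} = -ω_{-1}`          (`cayley_pullback`, `cayley_pullback_mone`)

and hence — by the change of variables `t_j = φ(s_{n+1-j})` on the simplex, Kontsevich–Zagier rules (2)+(1),
which is *not* formalised in this file — the integer relations

`(OCT)  I(0; a₁,…,a_n; 1) = ev Φ(a₁ ⋯ a_n)`,  `Φ(a₁ ⋯ a_n) = ψ(a_n) ⋯ ψ(a₁)`,  `ψ(a) = -([φ a] - [-1])` (`a ≠ -1`), `ψ(-1) = [-1]`

among convergent words (hodge §8.15.1).  What this file certifies in the kernel: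

* `SoloBlindL4.cayley_val`: `φ` maps the letters `0, 1, i, -i` to `1, 0, -i, i` (as complex numbers);
* `SoloBlindL4.cayley_pullback`, `cayley_pullback_mone`: the 1-form identities above, over any field;
* `SoloBlindL4.Psi_involutive`, `Psi_star`, `Phi_involutive`: the induced substitution `Ψ` on the free algebra
  `R⟨0, 1, -1, i, -i⟩` (formal words) is an involutive algebra endomorphism commuting with word reversal, so the
  Cayley operator `Φ = Ψ ∘ reverse` of (OCT) is an INVOLUTION of the formal word module — the formal shadow of
  `φ ∘ φ = id`; in particular the (OCT) relations `w - Φ w` span the same module as the anti-invariants;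
* `SoloBlindL4.phi_convergent_first/last`: `Φ` maps convergent words (first letter `≠ 0`, last letter `≠ 1`) to
  combinations of convergent words (letterwise statement).

[folklore; the substitution is classical: Blümlein–Broadhurst–Vermaseren, *The Multiple Zeta Value Data Mine*,
Comput. Phys. Commun. 181 (2010) §2 ("pseudo-duality" at level 2, arXiv:0907.2557); Xu–Zhao, Indag. Math. 2024,
Thm 3.5 (level 4, arXiv:2208.09593)]
-/

namespace Summit.KontsevichZagierPeriods.KontsevichZagierPeriods.Theorems

/-- The five letters `0, 1, -1, i, -i` of the level-4 alphabet `μ₄ ∪ {0}`. -/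
inductive SoloBlindL4
  | zero | one | mone | i | mi
  deriving DecidableEq

namespace SoloBlindL4

/-- The complex point named by a letter. -/
def val : SoloBlindL4 → ℂ
  | zero => 0 | one => 1 | mone => -1 | i => Complex.I | mi => -Complex.I

/-- The Cayley involution on letters: `0 ↔ 1`, `i ↔ -i`; the letter `-1` (sent to `∞` by `φ`) is fixed
here as a placeholder — it is treated separately in `psi`. -/
def phi : SoloBlindL4 → SoloBlindL4
  | zero => one | one => zero | mone => mone | i => mi | mi => i

/-- `φ(0) = 1`. -/
@[simp] theorem phi_zero : phi zero = one := rfl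
/-- `φ(1) = 0`. -/
@[simp] theorem phi_one : phi one = zero := rfl
/-- placeholder value at `-1` (`φ(-1) = ∞`). -/
@[simp] theorem phi_mone : phi mone = mone := rfl
/-- `φ(i) = -i`. -/
@[simp] theorem phi_i : phi i = mi := rfl
/-- `φ(-i) = i`. -/
@[simp] theorem phi_mi : phi mi = i := rfl

/-- `φ` is an involution on letters. -/
theorem phi_phi (a : SoloBlindL4) : phi (phi a) = a := by
  cases a <;> rfl

/-- Convergence of words is preserved letterwise: the LAST letter of `Φ(w)` is `φ(a₁)` or `-1`, never `1`
when `a₁ ≠ 0` … -/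
theorem phi_convergent_last (a : SoloBlindL4) (h : a ≠ zero) : phi a ≠ one ∧ mone ≠ one := by
  cases a <;> simp_all [phi]

/-- … and the FIRST letter of `Φ(w)` is `φ(a_n)` or `-1`, never `0` when `a_n ≠ 1`. -/
theorem phi_convergent_first (a : SoloBlindL4) (h : a ≠ one) : phi a ≠ zero ∧ mone ≠ zero := by
  cases a <;> simp_all [phi]

/-- `1 + i ≠ 0`. -/
private theorem one_add_I_ne_zero : (1 : ℂ) + Complex.I ≠ 0 := by
  intro h
  have := congrArg Complex.re h
  simp at this

/-- `1 - i ≠ 0`. -/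
private theorem one_sub_I_ne_zero : (1 : ℂ) - Complex.I ≠ 0 := by
  intro h
  have := congrArg Complex.re h
  simp at this

/-- `φ(t) = (1 - t)/(1 + t)` realises `phi` on the letters `0, 1, i, -i` (the letter `-1` goes to `∞`). -/
theorem cayley_val (a : SoloBlindL4) (ha : a ≠ mone) :
    (1 - val a) / (1 + val a) = val (phi a) := by
  cases a with
  | zero => simp [val]
  | one => simp [val]
  | mone => exact absurd rfl ha
  | i =>
    simp only [val, phi]
    rw [div_eq_iff one_add_I_ne_zero]
    ring_nf
    rw [Complex.I_sq]
    ring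
  | mi =>
    simp only [val, phi]
    have h : (1 : ℂ) + -Complex.I ≠ 0 := by simpa [sub_eq_add_neg] using one_sub_I_ne_zero
    rw [div_eq_iff h]
    ring_nf
    rw [Complex.I_sq]
    ring

/-- `φ` is an involution of the line: `φ(φ(s)) = s` (where defined; `2 ≠ 0` is needed since in characteristic 2
the map `φ` is constant). -/
theorem cayley_cayley {K : Type*} [Field K] (s : K) (hs : 1 + s ≠ 0) (h2 : (2 : K) ≠ 0) :
    (1 - (1 - s) / (1 + s)) / (1 + (1 - s) / (1 + s)) = s := by
  rw [one_sub_div hs, one_add_div hs, div_div_div_cancel_right₀ hs]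
  rw [show (1 + s - (1 - s)) = s * 2 by ring, show (1 + s + (1 - s)) = (2 : K) by ring]
  exact mul_div_cancel_right₀ s h2

/-- **Pull-back of the level-4 forms along the Cayley involution.**  With `t = φ(s) = (1 - s)/(1 + s)`,
`dt = -2 ds/(1 + s)²`, and for a pole `a ≠ -1`:
`φ'(s) / (φ(s) - a) = 1/(s - φ(a)) - 1/(s + 1)`, i.e. `φ*ω_a = ω_{φ(a)} - ω_{-1}`. -/
theorem cayley_pullback {K : Type*} [Field K] (a s : K) (ha : 1 + a ≠ 0) (hs : 1 + s ≠ 0)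
    (h : (1 - s) - (1 + s) * a ≠ 0) :
    (-2 / (1 + s) ^ 2) / ((1 - s) / (1 + s) - a) = 1 / (s - (1 - a) / (1 + a)) - 1 / (1 + s) := by
  have hB : s * (1 + a) - (1 - a) ≠ 0 := by
    intro h0
    apply h
    linear_combination (-1 : K) * h0
  rw [div_sub' (hc := hs), sub_div' (hc := ha)]
  have e1 : (-2 / (1 + s) ^ 2) / ((1 - s - (1 + s) * a) / (1 + s)) = -2 / ((1 + s) * (1 - s - (1 + s) * a)) := by
    rw [div_div_div_eq, pow_two, mul_comm (-2 : K) (1 + s), mul_assoc, mul_div_mul_left _ _ hs]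
  have e2 : 1 / ((s * (1 + a) - (1 - a)) / (1 + a)) - 1 / (1 + s)
      = -2 / ((1 + s) * (1 - s - (1 + s) * a)) := by
    rw [one_div_div, div_sub_div _ _ hB hs, div_eq_div_iff (mul_ne_zero hB hs) (mul_ne_zero hs h)]
    ring
  rw [e1, e2]

/-- The pole `a = -1` (which `φ` sends to `∞`): `φ'(s)/(φ(s) + 1) = -1/(1 + s)`, i.e. `φ*ω_{-1} = -ω_{-1}`. -/
theorem cayley_pullback_mone {K : Type*} [Field K] (s : K) (hs : 1 + s ≠ 0) (h2 : (2 : K) ≠ 0) :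
    (-2 / (1 + s) ^ 2) / ((1 - s) / (1 + s) + 1) = -1 / (1 + s) := by
  rw [div_add' _ _ _ hs, show (1 - s + 1 * (1 + s)) = (2 : K) by ring]
  rw [div_div_eq_mul_div, div_mul_eq_mul_div, pow_two, div_div,
    div_eq_div_iff (mul_ne_zero (mul_ne_zero hs hs) h2) hs]
  ring

section Formal

variable (R : Type*) [CommRing R]

open FreeAlgebra

/-- The letter substitution of the Cayley pull-back INCLUDING the orientation sign of `ds`:
`ψ(a) = -([φ a] - [-1])` for `a ≠ -1` and `ψ(-1) = [-1]` (from `φ*ω_a = ω_{φ a} - ω_{-1}`, `φ*ω_{-1} = -ω_{-1}`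
and one factor `-1` per variable from reversing the orientation of `[0,1]`). -/
def psi : SoloBlindL4 → FreeAlgebra R SoloBlindL4
  | zero => -(ι R one - ι R mone)
  | one => -(ι R zero - ι R mone)
  | mone => ι R mone
  | i => -(ι R mi - ι R mone)
  | mi => -(ι R i - ι R mone)

/-- The substitution extended multiplicatively to formal words (the free algebra on the five letters). -/
def Psi : FreeAlgebra R SoloBlindL4 →ₐ[R] FreeAlgebra R SoloBlindL4 :=
  FreeAlgebra.lift R (psi R)

/-- `Ψ` on a single letter is `ψ`. -/
@[simp] theorem Psi_ι (a : SoloBlindL4) : Psi R (ι R a) = psi R a := by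
  simp [Psi]

/-- `Ψ ∘ Ψ = id`: the formal shadow of `φ ∘ φ = id`. -/
theorem Psi_comp_Psi : (Psi R).comp (Psi R) = AlgHom.id R (FreeAlgebra R SoloBlindL4) := by
  refine FreeAlgebra.hom_ext ?_
  funext a
  cases a <;> simp [psi, map_sub]

/-- `Ψ (Ψ x) = x` for every formal word combination `x`. -/
theorem Psi_involutive (x : FreeAlgebra R SoloBlindL4) : Psi R (Psi R x) = x := by
  have h := congrArg (fun f : FreeAlgebra R SoloBlindL4 →ₐ[R] FreeAlgebra R SoloBlindL4 => f x)
    (Psi_comp_Psi R)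
  simpa using h

/-- `Ψ` commutes with word reversal (`star` on the free algebra). -/
theorem Psi_star (x : FreeAlgebra R SoloBlindL4) : Psi R (star x) = star (Psi R x) := by
  induction x using FreeAlgebra.induction with
  | grade0 r => simp [AlgHom.commutes]
  | grade1 a => cases a <;> simp [psi, star_sub]
  | mul a b ha hb => simp [star_mul, map_mul, ha, hb]
  | add a b ha hb => simp [star_add, map_add, ha, hb]

/-- **The Cayley operator on formal level-4 words**: reverse the word and substitute `ψ` letterwise —
`Φ(a₁ ⋯ a_n) = ψ(a_n) ⋯ ψ(a₁) = (-1)^n Σ_b (±) b₁ ⋯ b_n`, `b_k ∈ {φ(a_{n+1-k}), -1}` (hodge §8.15.1 (OCT)). -/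
def Phi (x : FreeAlgebra R SoloBlindL4) : FreeAlgebra R SoloBlindL4 :=
  Psi R (star x)

/-- `Φ` is an anti-homomorphism: it reverses products. -/
theorem Phi_mul (x y : FreeAlgebra R SoloBlindL4) : Phi R (x * y) = Phi R y * Phi R x := by
  simp [Phi, star_mul, map_mul]

/-- `Φ` on a single letter is `ψ`. -/
theorem Phi_ι (a : SoloBlindL4) : Phi R (ι R a) = psi R a := by
  simp [Phi]

/-- **`Φ` is an involution** of the formal word algebra: applying the Cayley pull-back twice returns every
formal word to itself; consequently the (OCT) relation module `{w - Φ w}` is `Φ`-stable and equals the image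
of `1 - Φ`. -/
theorem Phi_involutive (x : FreeAlgebra R SoloBlindL4) : Phi R (Phi R x) = x := by
  simp only [Phi]
  rw [← Psi_star, star_star, Psi_involutive]

/-- Worked instance (weight 2): `Φ([i][0]) = ψ(0) ψ(i) = ([1] - [-1]) ([-i] - [-1])`. -/
example : Phi R (ι R i * ι R zero) = (ι R one - ι R mone) * (ι R mi - ι R mone) := by
  rw [Phi_mul, Phi_ι, Phi_ι]
  simp only [psi]
  simp only [neg_mul, mul_neg, neg_neg]

end Formal

end SoloBlindL4

end Summit.KontsevichZagierPeriods.KontsevichZagierPeriods.Theorems
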